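import Summits.ResolutionOfSingularities.ResolutionOfSingularities.Theorems.HilbertSamuelEliminationCampaignW42Tertiary
import HarnessLib

/-!
# [OURS · L1 W4.2] Near-chain termination at ARBITRARY maximal strata — the O2-type statement without the isolation
# `X(ν) = {x}` (informal crux `TertiaryTermination`, stmt-ResolutionOfSingularities-17846; campaign s42 of cell
# res-hironaka, LADDER-RESOLUTION rung L, D-0089; `--kind definition --supports stmt-ResolutionOfSingularities-17846`)

HONEST FRAMING. Everything below is OURS (slot W4.2, prover seat res-L1-s42-pv-2 on the seat brief; res-L1-s42-plan-1 /
the OURS typer may supersede) over the TREE's published-mathematics library (`CanonicalEliminationSequence.lean`,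
`HilbertSamuelStrata.lean`, `DirectrixScheme.lean`) and the signed OURS statement file
`HilbertSamuelEliminationCampaignW42Tertiary.lean` (p471660/p474474, OURS-DESK #39). NOTHING here is a statement of
H. Hironaka's manuscript [Hironaka2017]; nothing is asserted: every claim-shaped decl is a `def … : Prop` or a
`structure … : Prop`. AI review is weaker than expert review. No `sorry`, no theorem (statement-only; the sorry-free
links are the sibling PROOF file `HilbertSamuelEliminationCampaignW42NearChainCorridor3.lean`).

WHY THIS FILE. The statements of `…CampaignW42Tertiary.lean` (`TertiaryTerminationAt p e`, `TertiaryTermination p`, the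
slots) are made at ISOLATED origins `X(ν) = {x}` — CJS's normalisation «we may assume that `X(ν̃)` just consists of
`x`» (LNM 2270 p. 98 Step 9, p. 107), available in dimension two. The kernel calibration against the crux
`SigmaMaxModificationsCorridor3` (stmt-…-19249; `…CampaignW42TertiaryCorridor3.lean`, p486973) showed that what the
crux consumes, modulo the printed resolution of excellent surfaces (CJS Thm. 1.2), is the SAME no-infinite-near-chain
statement FROM EVERY CLOSED POINT OF AN ARBITRARY MAXIMAL STRATUM of a threefold (and of its blow-ups), where no
reduction to the isolated case is known. This file gives that statement a name, graded by the geometric directrix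
dimension exactly as before, so that it can be carried as ONE typed open item:

* `IsMaximalOrigin p N ν X x` — THE SCOPE without isolation: `X` reduced, separated, of finite type over a field of
  characteristic `p`, `dim X ≤ N`, `ν ∈ Σ_X(N)^max`, `x` a CLOSED point of `X(ν)` (any shape of `X(ν)`).
* `NearChainTerminationAt p e` — [OURS · L1 W4.2] replaces the role of CJS Key Theorems 6.35/6.40 AT GEOMETRIC
  DIRECTRIX DIMENSION `e` from an ARBITRARY closed point of a maximal stratum: for every functional admissible oracle,
  level, maximal value and maximal origin, no infinite chain of closed near points along `S(X, ν)` of grade `e`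
  throughout. Implies `TertiaryTerminationAt p e` (proof file).
* `NearChainTermination p` — the ungraded statement: (B)_p of the calibration theorem. Implies `TertiaryTermination p`;
  `(∀ p prime, NearChainTermination p)` and CJS Thm. 1.2 imply the route decl `SigmaMaxModificationsCorridor3` (proof
  file, via p486973).

DESIGN POINTS. (i) Same oracle discipline as desk #39 (all functional admissible oracles; lane-B note (b) applies
verbatim: stronger than the crux in a declared way; the proof files also give the ∃-oracle forms). (ii) Grading by
`ē = Scheme.geomDirDim` as before; the assembly over grades needs `GeomDirDimNonincrease`-type monotonicity at
non-isolated origins, not restated here. (iii) VACUITY: not provable by logic — near closed points exist (W1 of K4.2,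
Hironaka's quadric); refutable by ONE admissible functional oracle with an infinite chain (a K4.2-type loop).
(iv) For `dim X ≤ 2` this is CJS Thm. 6.28's termination content (pp. 104–107 with Rem. 6.29 (4)); open from `dim 3`.

## References

* V. Cossart, U. Jannsen, S. Saito, *Desingularization: Invariants and Strategy*, LNM 2270 (2020): §1.3 p. 4, p. 98
  Step 9, p. 107, Rem. 6.29 (1)/(4), Thm. 6.28, Thms. 6.35/6.40, Def. 2.26, Def. 2.28. [CossartJannsenSaito2020]
* OURS files: `…CampaignW42Tertiary.lean` (p474474), `…CampaignW42TertiaryCorridor3.lean` (p486973); route file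
  Theses/HilbertSamuelElimination.lean (items 17846, 19249).
-/

noncomputable section

set_option linter.dupNamespace false -- mandated namespace of this single-conjunct summit

open CategoryTheory AlgebraicGeometry TopologicalSpace

namespace Summit.ResolutionOfSingularities.ResolutionOfSingularities.Theorems

namespace CampaignW42

open Literature.AlgebraicGeometry.Resolution

universe u

/-- [OURS · L1 W4.2] THE SCOPE WITHOUT ISOLATION: a MAXIMAL ORIGIN `(X, x)` of characteristic `p` at level `N` and
value `ν` — `X` reduced, separated and of finite type over a field of characteristic `p`, `dim X ≤ N`, `ν` a MAXIMAL
value of `H^N_X`, and `x` a CLOSED point of the `ν`-stratum `X(ν)` (of any shape). Compare `IsIsolatedOrigin`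
(`X(ν) = {x}`). NOT a statement of the manuscript. [folklore] -/
structure IsMaximalOrigin (p N : ℕ) (ν : ℕ → ℕ) (X : Scheme.{u}) (x : X) : Prop where
  /-- `X` is reduced, separated and of finite type over some field of characteristic `p` -/
  exists_structure : ∃ (k : Type u) (_ : Field k) (_ : CharP k p) (f : X ⟶ Spec (.of k)),
    IsSeparated f ∧ LocallyOfFiniteType f ∧ QuasiCompact f
  /-- `X` is reduced -/
  isReduced : IsReduced X
  /-- the level bounds the dimension, `dim X ≤ N` -/
  dim_le : topologicalKrullDim X ≤ (N : WithBot ℕ∞)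
  /-- `ν` is a maximal value of `H^N_X` -/
  maximal : Maximal (· ∈ Scheme.hsValues X N) ν
  /-- `x` is a closed point -/
  isClosed : IsClosed ({x} : Set X)
  /-- `x` lies in the `ν`-stratum -/
  mem_stratum : x ∈ Scheme.hsStratum X N ν

/-- [OURS · L1 W4.2] NEAR-CHAIN TERMINATION AT GEOMETRIC DIRECTRIX DIMENSION `e`, ARBITRARY MAXIMAL STRATUM — replaces
the role of CJS Key Theorems 6.35/6.40 at grade `e` WITHOUT `ē ≤ 2` and WITHOUT the isolation `X(ν) = {x}`: for every
functional admissible oracle `R`, level `N`, value `ν` and maximal origin `(X, x)` of characteristic `p`, along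
`S(X, ν)` there is NO infinite chain of closed points `x = x_0 ← x_1 ← ⋯`, `x_{n+1} ∈ X_{n+1}(ν)` above `x_n`, with
`ē_{x_n}(X_n) = e` for all `n` (CJS p. 107 without «e = ē = 2» and without p. 98 Step 9). Grades `e ≥ 3`: OPEN (O2);
implies `TertiaryTerminationAt p e`. Informal crux `TertiaryTermination` (stmt-ResolutionOfSingularities-17846); NOT a
statement of the manuscript. [folklore] -/
def NearChainTerminationAt (p e : ℕ) : Prop :=
  ∀ (R : ∀ S : Scheme.{u}, CentreSeq S → Prop), OracleFunctional R → OracleAdmissible R →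
  ∀ (N : ℕ) (ν : ℕ → ℕ) (X : Scheme.{u}) [IsLocallyNoetherian X] (x : X), IsMaximalOrigin p N ν X x →
    NoNearChainFrom R N ν (MarkedStage.init X x) fun s => s.geomDirDim = e

/-- [OURS · L1 W4.2] NEAR-CHAIN TERMINATION, UNGRADED, ARBITRARY MAXIMAL STRATUM — hypothesis (B)_p of the calibration
theorem `sigmaMaxModificationsCorridor3_of_noNearChains` (p486973): for every functional admissible oracle, level,
value and maximal origin of characteristic `p`, `S(X, ν)` admits no infinite chain of closed near points at all. With
the printed resolution of excellent surfaces (CJS Thm. 1.2) it yields `Σ^max`-modifications of every reduced scheme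
of dimension `≤ 3` over a field of characteristic `p`, in particular the crux `SigmaMaxModificationsCorridor3`
(stmt-…-19249) when assumed for all primes (proof file). Implies `TertiaryTermination p`. OPEN from dimension three.
Informal crux `TertiaryTermination` (stmt-…-17846); NOT a statement of the manuscript. [folklore] -/
def NearChainTermination (p : ℕ) : Prop :=
  ∀ (R : ∀ S : Scheme.{u}, CentreSeq S → Prop), OracleFunctional R → OracleAdmissible R →
  ∀ (N : ℕ) (ν : ℕ → ℕ) (X : Scheme.{u}) [IsLocallyNoetherian X] (x : X), IsMaximalOrigin p N ν X x →
    NoNearChainFrom R N ν (MarkedStage.init X x) fun _ => True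

end CampaignW42

end Summit.ResolutionOfSingularities.ResolutionOfSingularities.Theorems

end
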